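import Literature.AnabelianGeometry.SemiGraphs.ArithMaximalCompact
import HarnessLib

/-!
# [SemiAnbd] Theorem 5.4 (ii): nested edge-like subgroups; edge-like subgroups as the
# intersection of their two verticial hosts — from Thm 5.4 (i), Rmk 5.3.1 and estrangement

Mochizuki, *Semi-graphs of anabelioids*, Publ. RIMS **42** (2006), §5, Theorem 5.4 p. 66
[cite: MochizukiSemiAnbd2006, Thm 5.4 (ii), p. 66] ("The arithmetically ample intersections of two
distinct arithmetically maximal compact subgroups of `π₁^temp(𝔊)` are precisely the edge-like
subgroups"; proof "entirely parallel to the proofs of Theorem 3.7, Corollary 3.9"), over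
abc-iut-L3-t3's typing `ArithMaximalCompact.lean` (`D : DecompositionData Gtp V B`,
`aug : Gtp →* PA`).

PROOF-ONLY companion (sub-DAG Thm 5.4 of plan/L3, row T54-4c, seat abc-iut-w4-d098; no definition).
From the typed Thm 5.4 (i) (`ArithMaximalCompactStatementI`), the first sentence of Rmk 5.3.1
(`VerticialEdgeLikeCompactAmpleStatement`), the printed hypothesis "totally arithmetically
estranged" (`IsTotallyArithEstranged`, Def 5.3 (ii)) and four DATA-LEVEL inputs stated as inline
hypotheses — `hconj` (the decomposition groups of the two branches of one edge are conjugate, p. 65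
"well-defined up to conjugation"), `hgraph` (every branch abuts to a vertex: Thm 5.4 is about
GRAPHS of anabelioids), `htwo` (every edge has a second branch) and `hVR` (verticial rigidity:
`h·Π_{𝔊,v'}·h⁻¹ = Π_{𝔊,v}` only for `v' = v`, `h ∈ Π_{𝔊,v}` — commensurable terminality plus
distinctness of the vertex decomposition groups) — we prove:
* `exists_hosts_of_isEdgeLike` — every edge-like subgroup lies in two DISTINCT verticial subgroups
  (the input `hβ₁` of abc-iut-w4-d085's `ArithEdgeLikeInfVerticial.lean`, here derived);
* `edgeLike_eq_inf_of_le_of_le` — an edge-like subgroup contained in two distinct verticial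
  subgroups is their intersection;
* `edgeLike_eq_of_le` — nested edge-like subgroups are equal (`hβ₂` of the T54 interface menu);
* `exists_eq_inf_of_isEdgeLike_of_estranged` — every edge-like subgroup is `W₁ ⊓ W₂` for two
  distinct verticial subgroups (`hEV`, the input of `arithMaximalCompactStatementII_of'`).
The key step is the printed estrangement (Def 5.3 (ii)): at one vertex, with the conjugating
element in the vertex group, nested branch groups are equal and the two branches of a loop are never
conjugate.
Pure group theory over Mathlib; nothing here asserts an input for any data, and nothing bears on
[IUTchIII] Cor. 3.12.
-/

namespace Literature.AnabelianGeometry.SemiGraphs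

universe u u' w w'

variable {Gtp : Type u} [Group Gtp] [TopologicalSpace Gtp]
variable {PA : Type u'} [Group PA] [TopologicalSpace PA]
variable {V : Type w} {B : Type w'}
variable {D : DecompositionData Gtp V B} {aug : Gtp →* PA}

/-! ### Conjugation bookkeeping (local) -/

omit [TopologicalSpace Gtp] in
/-- Membership in a conjugate subgroup. [folklore] -/
private theorem mem_conjSubgroup_iff {g x : Gtp} {K : Subgroup Gtp} :
    x ∈ conjSubgroup g K ↔ g⁻¹ * x * g ∈ K := by
  constructor
  · rintro ⟨y, hy, rfl⟩
    simpa [MulAut.conj_apply, mul_assoc] using hy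
  · intro h
    exact ⟨g⁻¹ * x * g, h, by simp [MulAut.conj_apply, mul_assoc]⟩

omit [TopologicalSpace Gtp] in
/-- Conjugation by a product is iterated conjugation. [folklore] -/
private theorem conjSubgroup_mul' (g h : Gtp) (K : Subgroup Gtp) :
    conjSubgroup (g * h) K = conjSubgroup g (conjSubgroup h K) := by
  ext x
  simp only [mem_conjSubgroup_iff, mul_inv_rev, mul_assoc]

omit [TopologicalSpace Gtp] in
/-- Conjugation by `1` is the identity. [folklore] -/
private theorem conjSubgroup_one' (K : Subgroup Gtp) : conjSubgroup 1 K = K := by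
  ext x
  simp [mem_conjSubgroup_iff]

omit [TopologicalSpace Gtp] in
/-- Conjugation by `g⁻¹` undoes conjugation by `g`. [folklore] -/
private theorem conjSubgroup_inv_conjSubgroup (g : Gtp) (K : Subgroup Gtp) :
    conjSubgroup g⁻¹ (conjSubgroup g K) = K := by
  rw [← conjSubgroup_mul', inv_mul_cancel, conjSubgroup_one']

omit [TopologicalSpace Gtp] in
/-- Conjugation is monotone. [folklore] -/
private theorem conjSubgroup_mono' (g : Gtp) {K L : Subgroup Gtp} (h : K ≤ L) :
    conjSubgroup g K ≤ conjSubgroup g L :=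
  Subgroup.map_mono h

omit [TopologicalSpace Gtp] in
/-- Conjugation reflects inclusions. [folklore] -/
private theorem conjSubgroup_le_iff' {g : Gtp} {K L : Subgroup Gtp} :
    conjSubgroup g K ≤ conjSubgroup g L ↔ K ≤ L := by
  refine ⟨fun h => ?_, conjSubgroup_mono' g⟩
  have h' := conjSubgroup_mono' g⁻¹ h
  rwa [conjSubgroup_inv_conjSubgroup, conjSubgroup_inv_conjSubgroup] at h'

omit [TopologicalSpace Gtp] in
/-- Conjugation by a fixed element is injective on subgroups. [folklore] -/
private theorem conjSubgroup_inj' {g : Gtp} {K L : Subgroup Gtp} :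
    conjSubgroup g K = conjSubgroup g L ↔ K = L := by
  refine ⟨fun h => le_antisymm ?_ ?_, fun h => h ▸ rfl⟩
  · exact conjSubgroup_le_iff'.mp h.le
  · exact conjSubgroup_le_iff'.mp h.ge

omit [TopologicalSpace Gtp] in
/-- A subgroup is stable under conjugation by its own elements. [folklore] -/
private theorem conjSubgroup_eq_self_of_mem' {g : Gtp} {K : Subgroup Gtp} (hg : g ∈ K) :
    conjSubgroup g K = K := by
  ext x
  rw [mem_conjSubgroup_iff]
  constructor
  · intro h
    have := K.mul_mem (K.mul_mem hg h) (K.inv_mem hg)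
    simpa [mul_assoc] using this
  · intro h
    exact K.mul_mem (K.mul_mem (K.inv_mem hg) h) hg

/-! ### Consequences of arithmetic estrangement at one vertex -/

omit [TopologicalSpace Gtp] in
/-- A branch group is edge-like (conjugator `1`).
[cite: MochizukiSemiAnbd2006, Def 5.3 (iii), p. 65] -/
private theorem isEdgeLike_brGp (b : B) : IsEdgeLike D (D.brGp b) :=
  ⟨b, 1, (conjSubgroup_one' _).symm⟩

/-- **Estrangement, nested form** (Def 5.3 (ii)): if `Π_{𝔊,b} ⊆ h·Π_{𝔊,b″}·h⁻¹` for branches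
`b, b″` abutting to the same vertex `v` and `h ∈ Π_{𝔊,v}`, then `b″ = b` and
`h·Π_{𝔊,b″}·h⁻¹ = Π_{𝔊,b}` — the intersection `Π_{𝔊,b} ∩ h·Π_{𝔊,b″}·h⁻¹ = Π_{𝔊,b}` is arithmetically
ample (Rmk 5.3.1), which estrangement forbids unless `b″ = b` and `h ∈ Π_{𝔊,b}`.
[cite: MochizukiSemiAnbd2006, Def 5.3 (ii), p. 65] -/
theorem brGp_eq_conj_of_le (hR : VerticialEdgeLikeCompactAmpleStatement D aug)
    (hEst : IsTotallyArithEstranged D aug) {b b'' : B} {v : V} (hb : D.abut b = some v)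
    (hb'' : D.abut b'' = some v) {h : Gtp} (hh : h ∈ D.vertGp v)
    (hle : D.brGp b ≤ conjSubgroup h (D.brGp b'')) :
    b'' = b ∧ conjSubgroup h (D.brGp b'') = D.brGp b := by
  have hamp : IsArithAmple aug (D.brGp b) := (hR _ (Or.inr (isEdgeLike_brGp b))).2
  obtain ⟨h1, h2⟩ := hEst (D.edgeOf b) b rfl v hb h hh
  have hbb : b'' = b := by
    by_contra hne
    exact h1 b'' hb'' hne (by rwa [inf_eq_left.mpr hle])
  subst hbb
  refine ⟨rfl, ?_⟩
  have hmem : h ∈ D.brGp b'' := by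
    by_contra hnot
    exact h2 hnot (by rwa [inf_eq_left.mpr hle])
  exact conjSubgroup_eq_self_of_mem' hmem

/-- **Estrangement, loop form**: two distinct branches `b ≠ b₂` abutting to the same vertex `v`
never have `Π_{𝔊,v}`-conjugate decomposition groups.
[cite: MochizukiSemiAnbd2006, Def 5.3 (ii), p. 65] -/
theorem false_of_brGp_eq_conj (hR : VerticialEdgeLikeCompactAmpleStatement D aug)
    (hEst : IsTotallyArithEstranged D aug) {b b₂ : B} {v : V} (hne : b₂ ≠ b)
    (hb : D.abut b = some v) (hb₂ : D.abut b₂ = some v) {c : Gtp} (hc : c ∈ D.vertGp v)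
    (heq : D.brGp b = conjSubgroup c (D.brGp b₂)) : False := by
  have hamp : IsArithAmple aug (D.brGp b) := (hR _ (Or.inr (isEdgeLike_brGp b))).2
  refine (hEst (D.edgeOf b) b rfl v hb c hc).1 b₂ hb₂ hne ?_
  rwa [← heq, inf_idem]

/-! ### The two hosts of an edge-like subgroup -/

section Hosts

variable (hR : VerticialEdgeLikeCompactAmpleStatement D aug) (hEst : IsTotallyArithEstranged D aug)
  (hconj : ∀ b b' : B, D.edgeOf b = D.edgeOf b' → ∃ h : Gtp, D.brGp b' = conjSubgroup h (D.brGp b))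
  (hgraph : ∀ b : B, ∃ v : V, D.abut b = some v)
  (htwo : ∀ b : B, ∃ b' : B, b' ≠ b ∧ D.edgeOf b' = D.edgeOf b)
  (hVR : ∀ (v v' : V) (h : Gtp),
    conjSubgroup h (D.vertGp v') = D.vertGp v → v' = v ∧ h ∈ D.vertGp v)
include hR hEst hconj hgraph htwo hVR

/-- **Every edge-like subgroup lies in two DISTINCT verticial subgroups** — the hosts
`g·Π_{𝔊,v}·g⁻¹`, `g c·Π_{𝔊,v₂}·(g c)⁻¹` of the two branches `b ↦ v`, `b₂ ↦ v₂` of its edge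
(`Π_{𝔊,b} = c·Π_{𝔊,b₂}·c⁻¹`); they are distinct, since equal hosts would make the edge a loop at `v`
whose two branch groups are `Π_{𝔊,v}`-conjugate (verticial rigidity), contradicting estrangement.
This is the input `hβ₁` of `ArithEdgeLikeInfVerticial.lean` (abc-iut-w4-d085).
[cite: MochizukiSemiAnbd2006, Thm 5.4 (ii), p. 66] -/
theorem exists_hosts_of_isEdgeLike {E : Subgroup Gtp} (hE : IsEdgeLike D E) :
    ∃ W₁ W₂ : Subgroup Gtp, IsVerticial D W₁ ∧ IsVerticial D W₂ ∧ W₁ ≠ W₂ ∧ E ≤ W₁ ∧ E ≤ W₂ := by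
  obtain ⟨b, g, rfl⟩ := hE
  obtain ⟨v, hb⟩ := hgraph b
  obtain ⟨b₂, hne, he⟩ := htwo b
  obtain ⟨v₂, hb₂⟩ := hgraph b₂
  obtain ⟨c, hc⟩ := hconj b₂ b he
  refine ⟨conjSubgroup g (D.vertGp v), conjSubgroup (g * c) (D.vertGp v₂), ⟨v, g, rfl⟩,
    ⟨v₂, g * c, rfl⟩, ?_, conjSubgroup_mono' g (D.brGp_le_vertGp b v hb), ?_⟩
  · intro heq
    rw [conjSubgroup_mul', conjSubgroup_inj'] at heq
    obtain ⟨hvv, hcv⟩ := hVR v v₂ c heq.symm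
    subst hvv
    exact false_of_brGp_eq_conj hR hEst hne hb hb₂ hcv hc
  · rw [hc, ← conjSubgroup_mul']
    exact conjSubgroup_mono' _ (D.brGp_le_vertGp b₂ v₂ hb₂)

omit hconj hgraph htwo in
/-- The same-host step: if `E = g·Π_{𝔊,b}·g⁻¹ ⊆ L = k·Π_{𝔊,b″}·k⁻¹` (`b ↦ v`, `b″ ↦ v″`) and
the hosts coincide, `k·Π_{𝔊,v″}·k⁻¹ = g·Π_{𝔊,v}·g⁻¹`, then `L = E` (verticial rigidity puts `g⁻¹k`
in `Π_{𝔊,v}`, then estrangement). [cite: MochizukiSemiAnbd2006, Def 5.3 (ii), p. 65] -/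
private theorem conj_brGp_eq_of_le_of_hosts_eq {b b'' : B} {v v'' : V} (hb : D.abut b = some v)
    (hb'' : D.abut b'' = some v'') {g k : Gtp}
    (hle : conjSubgroup g (D.brGp b) ≤ conjSubgroup k (D.brGp b''))
    (hhost : conjSubgroup k (D.vertGp v'') = conjSubgroup g (D.vertGp v)) :
    conjSubgroup k (D.brGp b'') = conjSubgroup g (D.brGp b) := by
  have h1 : conjSubgroup (g⁻¹ * k) (D.vertGp v'') = D.vertGp v := by
    rw [conjSubgroup_mul', hhost, conjSubgroup_inv_conjSubgroup]
  obtain ⟨hvv, hmem⟩ := hVR v v'' (g⁻¹ * k) h1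
  subst hvv
  have hle' : D.brGp b ≤ conjSubgroup (g⁻¹ * k) (D.brGp b'') := by
    have := conjSubgroup_mono' g⁻¹ hle
    rwa [conjSubgroup_inv_conjSubgroup, ← conjSubgroup_mul'] at this
  obtain ⟨-, heq⟩ := brGp_eq_conj_of_le hR hEst hb hb'' hmem hle'
  have := congrArg (conjSubgroup g) heq
  rwa [← conjSubgroup_mul', mul_inv_cancel_left] at this

/-- **An edge-like subgroup contained in two distinct verticial subgroups is their intersection**
(Thm 5.4 (ii), second sentence, the geometric content): by (i) `W₁ ⊓ W₂ =: L` is edge-like and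
contains `E`; the host of `E` is `W₁` or `W₂`; if a host of `L` (via either branch of its edge)
equals the host of `E`, estrangement at that vertex gives `L = E`; otherwise both hosts of `L`
equal the other `Wᵢ`, making the edge of `L` a loop with conjugate branch groups — excluded by
estrangement.
[cite: MochizukiSemiAnbd2006, Thm 5.4 (ii), p. 66] -/
theorem edgeLike_eq_inf_of_le_of_le (hI : ArithMaximalCompactStatementI D aug)
    {E W₁ W₂ : Subgroup Gtp} (hE : IsEdgeLike D E) (hW₁ : IsVerticial D W₁)
    (hW₂ : IsVerticial D W₂) (hne : W₁ ≠ W₂) (h₁ : E ≤ W₁) (h₂ : E ≤ W₂) : E = W₁ ⊓ W₂ := by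
  obtain ⟨hEc, hEa⟩ := hR E (Or.inr hE)
  obtain ⟨-, hI2⟩ := hI E hEc hEa
  obtain ⟨honly, hL⟩ := hI2 W₁ W₂ hW₁ hW₂ hne h₁ h₂
  obtain ⟨b, g, rfl⟩ := hE
  obtain ⟨b'', k, hLk⟩ := hL
  obtain ⟨v, hb⟩ := hgraph b
  obtain ⟨v'', hb''⟩ := hgraph b''
  have hEL : conjSubgroup g (D.brGp b) ≤ conjSubgroup k (D.brGp b'') := hLk ▸ le_inf h₁ h₂
  -- the host of `E` and the first host of `L`
  have hHE := honly _ ⟨v, g, rfl⟩ (conjSubgroup_mono' g (D.brGp_le_vertGp b v hb))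
  have hL1 : conjSubgroup k (D.brGp b'') ≤ conjSubgroup k (D.vertGp v'') :=
    conjSubgroup_mono' k (D.brGp_le_vertGp b'' v'' hb'')
  have hHL := honly _ ⟨v'', k, rfl⟩ (hEL.trans hL1)
  by_cases hs : conjSubgroup k (D.vertGp v'') = conjSubgroup g (D.vertGp v)
  · rw [hLk]; exact (conj_brGp_eq_of_le_of_hosts_eq hR hEst hVR hb hb'' hEL hs).symm
  -- the second host of `L`, through the other branch of its edge
  obtain ⟨b₂, hb₂ne, he⟩ := htwo b''
  obtain ⟨v₂, hb₂⟩ := hgraph b₂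
  obtain ⟨c, hc⟩ := hconj b₂ b'' he
  have hLk' : conjSubgroup k (D.brGp b'') = conjSubgroup (k * c) (D.brGp b₂) := by
    rw [hc, conjSubgroup_mul']
  have hL2 : conjSubgroup (k * c) (D.brGp b₂) ≤ conjSubgroup (k * c) (D.vertGp v₂) :=
    conjSubgroup_mono' _ (D.brGp_le_vertGp b₂ v₂ hb₂)
  have hHL2 := honly _ ⟨v₂, k * c, rfl⟩ ((hEL.trans_eq hLk').trans hL2)
  by_cases hs2 : conjSubgroup (k * c) (D.vertGp v₂) = conjSubgroup g (D.vertGp v)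
  · rw [hLk, hLk']
    exact (conj_brGp_eq_of_le_of_hosts_eq hR hEst hVR hb hb₂
      (hEL.trans_eq hLk') hs2).symm
  -- both hosts of `L` differ from the host of `E`: they coincide, and the edge of `L` is a loop
  -- with conjugate branch groups — impossible
  exfalso
  have hhosts : conjSubgroup k (D.vertGp v'') = conjSubgroup (k * c) (D.vertGp v₂) := by
    rcases hHE with hE1 | hE2
    · rcases hHL with hl | hl
      · exact absurd (hl.trans hE1.symm) hs
      · rcases hHL2 with hl2 | hl2
        · exact absurd (hl2.trans hE1.symm) hs2
        · exact hl.trans hl2.symm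
    · rcases hHL with hl | hl
      · rcases hHL2 with hl2 | hl2
        · exact hl.trans hl2.symm
        · exact absurd (hl2.trans hE2.symm) hs2
      · exact absurd (hl.trans hE2.symm) hs
  rw [conjSubgroup_mul', conjSubgroup_inj'] at hhosts
  obtain ⟨hvv, hcv⟩ := hVR v'' v₂ c hhosts.symm
  subst hvv
  exact false_of_brGp_eq_conj hR hEst hb₂ne hb'' hb₂ hcv hc

/-- **Nested edge-like subgroups are equal** (`hβ₂` of the Thm 5.4 interface menu): `E ⊆ E′`
edge-like; `E′` lies in two distinct verticial subgroups (`exists_hosts_of_isEdgeLike`), hence so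
does `E`, and `E = W₁ ⊓ W₂ ⊇ E′`. [cite: MochizukiSemiAnbd2006, Thm 5.4 (ii), p. 66] -/
theorem edgeLike_eq_of_le (hI : ArithMaximalCompactStatementI D aug) {E E' : Subgroup Gtp}
    (hE : IsEdgeLike D E) (hE' : IsEdgeLike D E') (hle : E ≤ E') : E = E' := by
  obtain ⟨W₁, W₂, hW₁, hW₂, hne, h₁, h₂⟩ :=
    exists_hosts_of_isEdgeLike hR hEst hconj hgraph htwo hVR hE'
  have hEinf := edgeLike_eq_inf_of_le_of_le hR hEst hconj hgraph htwo hVR hI hE hW₁ hW₂ hne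
    (hle.trans h₁) (hle.trans h₂)
  exact le_antisymm hle (hEinf ▸ le_inf h₁ h₂)

/-- **Every edge-like subgroup is the intersection of two distinct verticial subgroups**
(Thm 5.4 (ii), second sentence; the input `hEV` of `arithMaximalCompactStatementII_of'`, here
derived from (i), Rmk 5.3.1, estrangement and the four data-level inputs).
[cite: MochizukiSemiAnbd2006, Thm 5.4 (ii), p. 66] -/
theorem exists_eq_inf_of_isEdgeLike_of_estranged (hI : ArithMaximalCompactStatementI D aug)
    {K : Subgroup Gtp} (hK : IsEdgeLike D K) :
    ∃ W₁ W₂ : Subgroup Gtp, IsVerticial D W₁ ∧ IsVerticial D W₂ ∧ W₁ ≠ W₂ ∧ K = W₁ ⊓ W₂ := by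
  obtain ⟨W₁, W₂, hW₁, hW₂, hne, h₁, h₂⟩ :=
    exists_hosts_of_isEdgeLike hR hEst hconj hgraph htwo hVR hK
  exact ⟨W₁, W₂, hW₁, hW₂, hne,
    edgeLike_eq_inf_of_le_of_le hR hEst hconj hgraph htwo hVR hI hK hW₁ hW₂ hne h₁ h₂⟩

end Hosts

end Literature.AnabelianGeometry.SemiGraphs
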